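import Literature.AlgebraicGeometry.HodgeTheory.FermatHodgeCharactersPrimePow
import HarnessLib

/-!
# Three pairs and Aoki's `σ_{5,A}` are reachable at their own level — stub S16-R `stub_reach_of_pairedOrSigmaFive` of line `cancel-by-any-claim-lattice`, crux `HodgeFermatVarieties` (stmt-HodgeConjecture-1334)

Crux `HodgeFermatVarieties` (stmt-HodgeConjecture-1334), line `cancel-by-any-claim-lattice`, stub S16-R
`stub_reach_of_pairedOrSigmaFive` (programme S16 of the lead, "the Hodge sextuples at a level prime to
`6` are three pairs or `σ_{5,A}`"). THIS FILE: both shapes are ℤ-reachable from the printed supply AT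
THEIR OWN LEVEL (`k = 1`, no level change):

* three pairs `s = Q + (-Q)`, `Q` zero-free: `P :=` the pairs `{a, -a}`, `a ∈ Q` (first component of
  the supply, Aoki 1987 Thm. 1-1), `N := 0`, and `Σ_{a ∈ Q} {a, -a} = Q + (-Q)`
  (`FermatCharacter.sum_map_pair`);
* Aoki's standard sextuple `s = σ_{5,A} = {A + j (m/5) : j < 5} + {-5A}` (`5 ∣ m`, `5A ≠ 0`):
  `P := {s}`, `N := 0`; `s` is VERBATIM the fourth component of the supply with `p = 5`, `a = A`
  (after `((5 : ℕ) : ZMod m) = 5`), and Aoki's side condition `2 < (m/5)/(⟨A⟩, m/5)` holds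
  (`two_lt_div_gcd_of_progression_ne_zero`): the quotient `(m/5)/(⟨A⟩, m/5)` divides `m`, hence is
  coprime to `6`, hence odd; and it is not `1`, for otherwise `m/5 ∣ ⟨A⟩`, `⟨A⟩ = (m/5) k`, and the
  progression point `A + j (m/5)` with `j ≡ -k (mod 5)` would be `(m/5) · 5 · c = 0` in `ℤ/m` — but a
  Hodge multiset is zero-free.

Everything here is PROVED (no `sorry`, no new definition, no new named fact); only Mathlib and the
`IsHodgeMultiset` vocabulary of `FermatShiodaCondition` (zero-freeness `hs.1.1`) enter.

References: [Aoki1987] N. Aoki, Some new algebraic cycles on Fermat varieties, J. Math. Soc. Japan 39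
(1987) 385–396, Thm. 1-1 (pairs) and Thm. 2-1 (standard elements, p. 388).
-/

set_option linter.dupNamespace false

noncomputable section

open Finset
open Literature.AlgebraicGeometry.HodgeTheory Literature.AlgebraicGeometry.HodgeTheory.FermatCharacter

namespace Summit.HodgeConjecture.HodgeConjecture.Theorems.CancelByAnyClaimLattice.CoprimeSix

/-- `Supply[M]` — the printed supply of level `M` (local notation of the line, verbatim). -/
local notation3 (prettyPrint := false) "Supply[" M "]" =>
  ({s : Multiset (ZMod M) | ∃ a : ZMod M, a ≠ 0 ∧ s = ({a, -a} : Multiset (ZMod M))} ∪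
    {s : Multiset (ZMod M) | IsHodgeMultiset s ∧ Multiset.card s = 4} ∪
    {s : Multiset (ZMod M) | IsHodgeMultiset s ∧ IsSemiDecomposable s} ∪
    {s : Multiset (ZMod M) | ∃ (p : ℕ) (a : ZMod M), p.Prime ∧ p ≠ 2 ∧ p ∣ M ∧
        2 < (M / p) / Nat.gcd (ZMod.val a) (M / p) ∧
        s = Multiset.map (fun j : ℕ => a + (j : ZMod M) * ((M / p : ℕ) : ZMod M)) (Multiset.range p) +
              {-((p : ZMod M) * a)}} : Set (Multiset (ZMod M)))

/-- `Reach[M, s]` (local notation of the line, verbatim). -/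
local notation3 (prettyPrint := false) "Reach[" M ", " s "]" =>
  ∃ P N : Multiset (Multiset (ZMod M)),
    (∀ u ∈ P, u ∈ Supply[M]) ∧ (∀ u ∈ N, u ∈ Supply[M]) ∧ s + Multiset.sum N = Multiset.sum P

/-- **Aoki's side condition for a zero-free `5`-progression.** If `m` is coprime to `6`, `5 ∣ m`, and
none of the five points `A + j (m/5)`, `j < 5`, of `ℤ/m` vanishes, then `2 < (m/5) / (⟨A⟩, m/5)`:
the quotient divides `m`, so it is coprime to `6`, hence odd; and it is not `1`, since `m/5 ∣ ⟨A⟩`,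
say `⟨A⟩ = (m/5) k`, would make the point with `j ≡ -k (mod 5)` equal to `(m/5) (k + j) = m c = 0`.
(Aoki's condition `d/(⟨a⟩, d) > 2` on the standard elements `σ_{p,a}`, `d = m/p`.)
[cite: Aoki1987, Thm. 1-1 and Thm. 2-1 (p. 388)] -/
theorem two_lt_div_gcd_of_progression_ne_zero {m : ℕ} [NeZero m] (hm : m.Coprime 6) (h5 : 5 ∣ m)
    {A : ZMod m} (hA : ∀ j : ℕ, j < 5 → A + (j : ZMod m) * ((m / 5 : ℕ) : ZMod m) ≠ 0) :
    2 < (m / 5) / Nat.gcd A.val (m / 5) := by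
  have hmd : m / 5 * 5 = m := Nat.div_mul_cancel h5
  have hgd : Nat.gcd A.val (m / 5) ∣ m / 5 := Nat.gcd_dvd_right _ _
  -- the quotient divides `m`, hence is coprime to `6`, hence odd
  have hq_dvd : (m / 5) / Nat.gcd A.val (m / 5) ∣ m :=
    (Nat.div_dvd_of_dvd hgd).trans (Nat.div_dvd_of_dvd h5)
  have hq_cop : ((m / 5) / Nat.gcd A.val (m / 5)).Coprime 6 := Nat.Coprime.coprime_dvd_left hq_dvd hm
  have hodd : Odd ((m / 5) / Nat.gcd A.val (m / 5)) :=
    Nat.coprime_two_right.1 (Nat.Coprime.coprime_dvd_right (by norm_num : 2 ∣ 6) hq_cop)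
  -- the quotient is not `1`: otherwise `m / 5 ∣ ⟨A⟩` and the progression would pass through `0`
  have hq1 : (m / 5) / Nat.gcd A.val (m / 5) ≠ 1 := by
    intro h1
    have hdA : m / 5 ∣ A.val := by
      rw [← Nat.eq_of_dvd_of_div_eq_one hgd h1]
      exact Nat.gcd_dvd_left _ _
    obtain ⟨k, hk⟩ := hdA
    obtain ⟨c, hc⟩ : 5 ∣ k + (5 - k % 5) % 5 := by omega
    have e : m / 5 * k + (5 - k % 5) % 5 * (m / 5) = m * c :=
      calc m / 5 * k + (5 - k % 5) % 5 * (m / 5) = m / 5 * (k + (5 - k % 5) % 5) := by ring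
        _ = m / 5 * 5 * c := by rw [hc, mul_assoc]
        _ = m * c := by rw [hmd]
    refine hA ((5 - k % 5) % 5) (Nat.mod_lt _ (by norm_num)) ?_
    have key : A + (((5 - k % 5) % 5 : ℕ) : ZMod m) * ((m / 5 : ℕ) : ZMod m) =
        ((m / 5 * k + (5 - k % 5) % 5 * (m / 5) : ℕ) : ZMod m) := by
      rw [← ZMod.natCast_zmod_val A, hk]
      push_cast
      ring
    rw [key, e, Nat.cast_mul, ZMod.natCast_self, zero_mul]
  -- an odd natural number other than `1` exceeds `2`
  obtain ⟨r, hr⟩ := hodd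
  omega

/-- **S16-R `stub_reach_of_pairedOrSigmaFive` — both shapes of a Hodge sextuple at a level prime to `6`
are ℤ-reachable from the printed supply at their own level.** Three pairs `Q + (-Q)` (`Q` zero-free):
`P :=` the pairs `{a, -a}`, `a ∈ Q` (first component of the supply, Aoki Thm. 1-1), `N := 0`
(`sum_map_pair`). Aoki's `σ_{5,A} = {A + j (m/5) : j < 5} + {-5A}` with `5 ∣ m`, `5A ≠ 0`: `P := {s}`,
`N := 0`, `s` being verbatim the fourth component of the supply with `p = 5`, `a = A` (after
`((5 : ℕ) : ZMod m) = 5`, `Nat.cast_ofNat`); Aoki's side condition `2 < (m/5)/(⟨A⟩, m/5)` is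
`two_lt_div_gcd_of_progression_ne_zero`, the five progression points being entries of the zero-free
Hodge multiset `s`. (The hypothesis `#s = 6` is not used.) [cite: Aoki1987, Thm. 1-1 and Thm. 2-1 (p. 388)] -/
theorem stub_reach_of_pairedOrSigmaFive :
    ∀ (m : ℕ) [NeZero m], m.Coprime 6 → ∀ s : Multiset (ZMod m), IsHodgeMultiset s → Multiset.card s = 6 →
      ((∃ Q : Multiset (ZMod m), (∀ a ∈ Q, a ≠ 0) ∧ s = Q + Q.map (fun a ↦ -a)) ∨
        (5 ∣ m ∧ ∃ A : ZMod m, (5 : ZMod m) * A ≠ 0 ∧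
          s = (Multiset.range 5).map (fun i : ℕ ↦ A + (i : ZMod m) * ((m / 5 : ℕ) : ZMod m)) +
            {-((5 : ZMod m) * A)})) →
      Reach[m, s] := by
  intro m _ hm s hs _ h
  rcases h with ⟨Q, hQ, hsQ⟩ | ⟨h5, A, _, hsA⟩
  · -- three pairs: `P :=` the pairs of `Q`, `N := 0`
    refine ⟨Q.map fun a ↦ ({a, -a} : Multiset (ZMod m)), 0, fun u hu ↦ ?_,
      fun u hu ↦ absurd hu (Multiset.notMem_zero u), ?_⟩
    · obtain ⟨a, ha, rfl⟩ := Multiset.mem_map.1 hu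
      exact Or.inl (Or.inl (Or.inl ⟨a, hQ a ha, rfl⟩))
    · rw [Multiset.sum_zero, add_zero, sum_map_pair]
      exact hsQ
  · -- `σ_{5,A}`: `P := {s}`, `N := 0`, `s` in the fourth component with `p = 5`, `a = A`
    have hA0 : ∀ j : ℕ, j < 5 → A + (j : ZMod m) * ((m / 5 : ℕ) : ZMod m) ≠ 0 := fun j hj ↦
      hs.1.1 _ (by
        rw [hsA]
        exact Multiset.mem_add.2 (Or.inl (Multiset.mem_map.2 ⟨j, Multiset.mem_range.2 hj, rfl⟩)))
    refine ⟨{s}, 0, fun u hu ↦ ?_, fun u hu ↦ absurd hu (Multiset.notMem_zero u), by simp⟩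
    rw [Multiset.mem_singleton] at hu
    rw [hu, hsA]
    refine Or.inr ⟨5, A, Nat.prime_five, by norm_num, h5,
      two_lt_div_gcd_of_progression_ne_zero hm h5 hA0, ?_⟩
    simp only [Nat.cast_ofNat]

end Summit.HodgeConjecture.HodgeConjecture.Theorems.CancelByAnyClaimLattice.CoprimeSix

end
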